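import Literature.Analysis.FluidPDE.ESSLocalHolderBlowupFarField
import Literature.Analysis.FluidPDE.CKNOneScaleFromRRS
import Literature.Analysis.FluidPDE.CKNLocalRegularityRRSPressure
import HarnessLib

/-!
# ESS Thm. 1.4 (`ess_local_holder`): the blow-up limit is bounded in the far field
# (ESS 2003, §3 (3.22)–(3.24); Seregin 2014, §6.6, (6.6.10)–(6.6.12))

Analysis/FluidPDE proofs-only file (theorems only: no definitions, no named facts) in the
bottom-up discharge of `Literature.Analysis.FluidPDE.ess_local_holder` (L. Escauriaza,
G. Seregin, V. Šverák, Russ. Math. Surveys 58:2 (2003) 211–250, Thm. 1.4). The far-field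
smallness `∫_{-T-1}^0 ∫_{|x|>R₀} (|w|³ + |π|^{3/2}) < ε₀` of the blow-up limit
(`exists_farField_small`) feeds the one-scale ε-regularity theorem — here in the proved form of
Robinson–Rodrigo–Sadowski, Thm. 15.3 (`RRS2016.theorem15_3_holds`), applied on the unit
cylinders `Q₁(z₀)`, `z₀ = (t₀, x₀)`, `-T < t₀ < 0`, `|x₀| > R₀ + 1`, on which the limit is an
RRS suitable pair (`IsSuitableWeakSolutionOn.rrs_isSuitablePair`) — and yields ESS 2003, (3.24) /
Seregin 2014, (6.6.12) in its first, qualitative-bound form: **`|w| ≤ 1` a.e. on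
`]-T, 0[ × {|x| > R}`**.

* `ae_norm_le_one_near_farPoint` — the bound a.e. on `Q_{1/2}(z₀)` for every far point `z₀`;
* `exists_farField_ae_norm_le_one` — the bound a.e. on `]-T, 0[ × {|x| > R}` (countable dense
  family of far points).

Nothing accepted is restated or changed; no `sorry`.

## References

* L. Escauriaza, G. Seregin, V. Šverák, Russ. Math. Surveys 58:2 (2003) 211–250: §3 (3.22)–(3.24).
  [`EscauriazaSereginSverak2003`]
* G. Seregin, *Lecture Notes on Regularity Theory for the Navier–Stokes Equations*, World
  Scientific (2014), §6.6, (6.6.10)–(6.6.12). [`Seregin2014`]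
* J. C. Robinson, J. L. Rodrigo, W. Sadowski, *The Three-Dimensional Navier–Stokes Equations*,
  CUP (2016), Thm. 15.3. [`RobinsonRodrigoSadowski2016`]
-/

noncomputable section

open MeasureTheory Set Function Filter Topology TopologicalSpace Metric
open scoped NNReal ENNReal InnerProductSpace RealInnerProductSpace

namespace Literature.Analysis.FluidPDE

section FarFieldBound

variable {w : ℝ → EuclideanSpace ℝ (Fin 3) → EuclideanSpace ℝ (Fin 3)}
  {π : ℝ → EuclideanSpace ℝ (Fin 3) → ℝ}

/-- The closed unit cylinder at a point of negative time lies in a large cylinder `Q(a)` at the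
origin. [folklore] -/
theorem closure_unitCylinder_subset_origin {z₀ : ℝ × EuclideanSpace ℝ (Fin 3)} (ht₀ : z₀.1 < 0)
    {a : ℝ} (ha1 : 1 - z₀.1 < a) (ha2 : ‖z₀.2‖ + 1 < a) :
    closure (parabolicCylinder 1 z₀) ⊆
      ((parabolicCylinderOpens a (0 : ℝ × EuclideanSpace ℝ (Fin 3)) :
        Opens (ℝ × EuclideanSpace ℝ (Fin 3))) : Set (ℝ × EuclideanSpace ℝ (Fin 3))) := by
  have ha : 1 < a := by linarith
  have haa : a ≤ a ^ 2 := by nlinarith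
  refine (closure_parabolicCylinder_subset 1 z₀).trans ?_
  show Icc (z₀.1 - 1 ^ 2) z₀.1 ×ˢ closedBall z₀.2 1 ⊆ parabolicCylinder a (0 : ℝ × EuclideanSpace ℝ (Fin 3))
  rw [SuitableCompactness.parabolicCylinder_zero]
  refine prod_mono (fun t ht => ⟨?_, ?_⟩) (fun x hx => ?_)
  · have := ht.1; nlinarith
  · exact lt_of_le_of_lt ht.2 ht₀
  · rw [mem_closedBall, dist_eq_norm] at hx
    rw [mem_ball, dist_zero_right]
    calc ‖x‖ = ‖(x - z₀.2) + z₀.2‖ := by rw [sub_add_cancel]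
      _ ≤ ‖x - z₀.2‖ + ‖z₀.2‖ := norm_add_le _ _
      _ < a := by linarith

/-- **`|w| ≤ 1` a.e. near every far point** (ESS 2003, (3.24); Seregin 2014, (6.6.12), first
form): if `∫_{]-T-1,0[ × {|x| > R₀}} (|w|³ + |π|^{3/2}) < ε₀` with `ε₀ ≤ ε₁` and
`c_M ε₀^{1/3} ≤ 1` (`ε₁, c_M` the constants of RRS Thm. 15.3), then for every `z₀ = (t₀, x₀)` with
`-T < t₀ < 0` and `|x₀| > R₀ + 1`: `|w| ≤ 1` a.e. on `Q_{1/2}(z₀)`. [cite: EscauriazaSereginSverak2003, §3 (3.24)] [cite: RobinsonRodrigoSadowski2016, Thm. 15.3] -/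
theorem ae_norm_le_one_near_farPoint
    (hw : ∀ a : ℝ, 0 < a → IsSuitableWeakSolutionInBall a (0 : ℝ × EuclideanSpace ℝ (Fin 3)) w π)
    {ε₁ cM : ℝ}
    (H : ∀ (z₀ : ℝ × EuclideanSpace ℝ (Fin 3)) (u : ℝ → EuclideanSpace ℝ (Fin 3) → EuclideanSpace ℝ (Fin 3))
      (p : ℝ → EuclideanSpace ℝ (Fin 3) → ℝ)
      (G : ℝ → EuclideanSpace ℝ (Fin 3) → EuclideanSpace ℝ (Fin 3) →L[ℝ] EuclideanSpace ℝ (Fin 3)),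
      RRS2016.IsSuitablePair (parabolicCylinderOpens 1 z₀) 1 0 u p G →
      ∀ ε₀ : ℝ, 0 < ε₀ → ε₀ ≤ ε₁ → RRS2016.Small ε₀ u p z₀ →
        ∀ᵐ w ∂(volume.restrict (parabolicCylinder (1 / 2) z₀)), ‖u w.1 w.2‖ ≤ cM * ε₀ ^ (1 / 3 : ℝ))
    {ε₀ : ℝ} (hε₀ : 0 < ε₀) (hε₀₁ : ε₀ ≤ ε₁) (hcMε : cM * ε₀ ^ (1 / 3 : ℝ) ≤ 1)
    {T R₀ : ℝ}
    (hsmall : ∫⁻ z in Ioo (-(T + 1)) 0 ×ˢ (closedBall (0 : EuclideanSpace ℝ (Fin 3)) R₀)ᶜ,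
        (‖w z.1 z.2‖ₑ ^ (3 : ℕ) + ‖π z.1 z.2‖ₑ ^ (3 / 2 : ℝ)) < ENNReal.ofReal ε₀)
    {z₀ : ℝ × EuclideanSpace ℝ (Fin 3)} (hT : -T < z₀.1) (ht₀ : z₀.1 < 0) (hx₀ : R₀ + 1 < ‖z₀.2‖) :
    ∀ᵐ z ∂(volume.restrict (parabolicCylinder (1 / 2) z₀)), ‖w z.1 z.2‖ ≤ 1 := by
  -- the limit is an RRS suitable pair on `Q₁(z₀)`
  set a : ℝ := ‖z₀.2‖ + T + 2 with ha
  have hapos : 0 < a := by rw [ha]; have := norm_nonneg z₀.2; linarith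
  have hcl := closure_unitCylinder_subset_origin ht₀ (a := a) (by rw [ha]; have := norm_nonneg z₀.2; linarith)
    (by rw [ha]; linarith)
  have hsol := (hw a hapos).1
  have hfi : LocallyIntegrableOn (uncurry (0 : ℝ → EuclideanSpace ℝ (Fin 3) → EuclideanSpace ℝ (Fin 3)))
      ((parabolicCylinderOpens a (0 : ℝ × EuclideanSpace ℝ (Fin 3)) : Opens (ℝ × EuclideanSpace ℝ (Fin 3))) :
        Set (ℝ × EuclideanSpace ℝ (Fin 3))) volume :=
    (locallyIntegrable_zero).locallyIntegrableOn _
  have hdivf : ∀ φ : ℝ → EuclideanSpace ℝ (Fin 3) → ℝ,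
      IsSpaceTimeTestOn (parabolicCylinderOpens a (0 : ℝ × EuclideanSpace ℝ (Fin 3))) φ →
      ∫ t, ∫ x, ⟪(0 : ℝ → EuclideanSpace ℝ (Fin 3) → EuclideanSpace ℝ (Fin 3)) t x, gradient (φ t) x⟫ = 0 := by
    intro φ _; simp
  obtain ⟨G, hpair⟩ := hsol.rrs_isSuitablePair hfi hdivf hcl
  -- smallness on `Q₁(z₀) ⊆ ]-T-1, 0[ × {|x| > R₀}`
  have hsub : parabolicCylinder 1 z₀ ⊆ Ioo (-(T + 1)) 0 ×ˢ (closedBall (0 : EuclideanSpace ℝ (Fin 3)) R₀)ᶜ := by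
    rw [parabolicCylinder]
    refine prod_mono (fun t ht => ⟨?_, ?_⟩) (fun x hx => ?_)
    · have := ht.1; linarith
    · exact lt_of_lt_of_le ht.2 ht₀.le
    · rw [mem_ball, dist_eq_norm] at hx
      rw [mem_compl_iff, mem_closedBall, dist_zero_right, not_le]
      have : ‖z₀.2‖ ≤ ‖x‖ + ‖x - z₀.2‖ := by
        calc ‖z₀.2‖ = ‖x - (x - z₀.2)‖ := by rw [sub_sub_cancel]
          _ ≤ ‖x‖ + ‖x - z₀.2‖ := norm_sub_le _ _
      linarith
  have hSmall : RRS2016.Small ε₀ w π z₀ :=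
    ((lintegral_mono_set hsub).trans hsmall.le)
  filter_upwards [H z₀ w π G hpair ε₀ hε₀ hε₀₁ hSmall] with z hz
  exact hz.trans hcMε

/-- **The blow-up limit is bounded in the far field** (ESS 2003, §3 (3.22)–(3.24); Seregin 2014,
§6.6 (6.6.10)–(6.6.12), first form): for every `T > 0` there is `R > 0` with `|w| ≤ 1` a.e. on
`]-T, 0[ × {|x| > R}`. Proof: far-field smallness (`exists_farField_small`) at the level `ε₀`
dictated by RRS Thm. 15.3 (`RRS2016.theorem15_3_holds`), the bound near every far point
(`ae_norm_le_one_near_farPoint`), and a countable dense family of far points. [cite: EscauriazaSereginSverak2003, §3 (3.24)] [cite: Seregin2014, §6.6 (6.6.12)] -/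
theorem exists_farField_ae_norm_le_one {M D : ℝ≥0}
    (hw : ∀ a : ℝ, 0 < a → IsSuitableWeakSolutionInBall a (0 : ℝ × EuclideanSpace ℝ (Fin 3)) w π)
    (hM : ∀ a : ℝ, 0 < a → ∀ᵐ s ∂(volume.restrict (Ioo (-a ^ 2) 0)),
      ∫⁻ y in ball (0 : EuclideanSpace ℝ (Fin 3)) a, ‖w s y‖ₑ ^ (3 : ℕ) ≤ M)
    (hD : ∀ a : ℝ, 0 < a → cknD a (0 : ℝ × EuclideanSpace ℝ (Fin 3)) π ≤ D) {T : ℝ} (hT : 0 < T) :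
    ∃ R : ℝ, 0 < R ∧ ∀ᵐ z ∂(volume.restrict (Ioo (-T) 0 ×ˢ (closedBall (0 : EuclideanSpace ℝ (Fin 3)) R)ᶜ)),
      ‖w z.1 z.2‖ ≤ 1 := by
  obtain ⟨ε₁, cM, hε₁, hcM, H⟩ := RRS2016.theorem15_3_holds
  -- the smallness level
  set ε₀ : ℝ := min ε₁ (cM⁻¹ ^ 3) with hε₀def
  have hε₀ : 0 < ε₀ := lt_min hε₁ (by positivity)
  have hε₀₁ : ε₀ ≤ ε₁ := min_le_left _ _
  have hcMε : cM * ε₀ ^ (1 / 3 : ℝ) ≤ 1 := by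
    have h1 : ε₀ ^ (1 / 3 : ℝ) ≤ (cM⁻¹ ^ 3) ^ (1 / 3 : ℝ) :=
      Real.rpow_le_rpow hε₀.le (min_le_right _ _) (by norm_num)
    have h2 : (cM⁻¹ ^ 3 : ℝ) ^ (1 / 3 : ℝ) = cM⁻¹ := by
      rw [show (1 / 3 : ℝ) = ((3 : ℕ) : ℝ)⁻¹ by norm_num]
      exact Real.pow_rpow_inv_natCast (by positivity) three_ne_zero
    rw [h2] at h1
    calc cM * ε₀ ^ (1 / 3 : ℝ) ≤ cM * cM⁻¹ := mul_le_mul_of_nonneg_left h1 hcM.le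
      _ = 1 := mul_inv_cancel₀ hcM.ne'
  -- far-field smallness on `]-T-1, 0[`
  obtain ⟨R₀, hR₀, hsmall⟩ := exists_farField_small hw hM hD (T := T + 1) (by linarith)
    (ENNReal.ofReal_pos.2 hε₀)
  refine ⟨R₀ + 1, by linarith, ?_⟩
  -- a countable dense family of far points
  obtain ⟨s, hsc, hsd⟩ := TopologicalSpace.exists_countable_dense (ℝ × EuclideanSpace ℝ (Fin 3))
  set s' : Set (ℝ × EuclideanSpace ℝ (Fin 3)) :=
    {z₀ ∈ s | -T < z₀.1 ∧ z₀.1 < 0 ∧ R₀ + 1 < ‖z₀.2‖} with hs'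
  have hs'c : s'.Countable := hsc.mono (sep_subset _ _)
  have hall : ∀ᵐ z ∂(volume : Measure (ℝ × EuclideanSpace ℝ (Fin 3))), ∀ z₀ ∈ s',
      z ∈ parabolicCylinder (1 / 2) z₀ → ‖w z.1 z.2‖ ≤ 1 := by
    rw [ae_ball_iff hs'c]
    rintro z₀ ⟨-, h1, h2, h3⟩
    have h := ae_norm_le_one_near_farPoint hw H hε₀ hε₀₁ hcMε hsmall h1 h2 h3
    exact (ae_restrict_iff' (isOpen_parabolicCylinder _ _).measurableSet).1 h
  have hmeas : MeasurableSet (Ioo (-T) 0 ×ˢ (closedBall (0 : EuclideanSpace ℝ (Fin 3)) (R₀ + 1))ᶜ) :=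
    measurableSet_Ioo.prod measurableSet_closedBall.compl
  filter_upwards [ae_restrict_of_ae (μ := volume) (s := Ioo (-T) 0 ×ˢ (closedBall (0 : EuclideanSpace ℝ (Fin 3)) (R₀ + 1))ᶜ) hall,
    ae_restrict_mem hmeas] with z hz hzmem
  obtain ⟨⟨hzt1, hzt2⟩, hzx⟩ := hzmem
  rw [mem_compl_iff, mem_closedBall, dist_zero_right, not_le] at hzx
  -- a far point `z₀ ∈ s` with `z ∈ Q_{1/2}(z₀)`
  set U : Set (ℝ × EuclideanSpace ℝ (Fin 3)) :=
    Ioo z.1 (min 0 (z.1 + 1 / 4)) ×ˢ (ball z.2 (1 / 2) ∩ {x | R₀ + 1 < ‖x‖}) with hU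
  have hUo : IsOpen U :=
    isOpen_Ioo.prod (isOpen_ball.inter (isOpen_lt continuous_const continuous_norm))
  have hUne : U.Nonempty := by
    have ht : z.1 < min 0 (z.1 + 1 / 4) := lt_min hzt2 (by linarith)
    obtain ⟨t, ht1, ht2⟩ := exists_between ht
    exact ⟨(t, z.2), ⟨ht1, ht2⟩, mem_ball_self (by norm_num), hzx⟩
  obtain ⟨z₀, hz₀U, hz₀s⟩ := hsd.inter_open_nonempty U hUo hUne
  obtain ⟨⟨hτ1, hτ2⟩, hξ1, hξ2⟩ := hz₀U
  have hτ0 : z₀.1 < 0 := lt_of_lt_of_le hτ2 (min_le_left _ _)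
  have hτ3 : z₀.1 < z.1 + 1 / 4 := lt_of_lt_of_le hτ2 (min_le_right _ _)
  refine hz z₀ ⟨hz₀s, by linarith, hτ0, hξ2⟩ ?_
  rw [parabolicCylinder]
  refine ⟨⟨by nlinarith, hτ1⟩, ?_⟩
  rw [mem_ball, dist_comm]
  exact hξ1

end FarFieldBound

end Literature.Analysis.FluidPDE
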